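import Summits.QuantumFields.BalabanUV.Beta.AdjointCarrierWiring
import Summits.QuantumFields.BalabanUV.T4Continuum.Spine.NE2.OneStepRemainderCoefficients

/-!
# T⁴ programme, spine node NE2 (U1a) — R14 W3b′: THE INFINITESIMAL ADJOINT CARRIER `i·ad_Y ↦ o×o MATRIX` IN THE β CELL's COMPONENT BASIS, ITS SIZE `‖cpx(adLie Y)‖ ≤ 2‖Y‖`, AND
# (124)'s COEFFICIENT OPERATORS AS FUNCTIONS OF THE LOOP LOGARITHMS (cell `pub-balaban-gaps`, seat ne2 gen 5)

[B7] p. 22: «we will treat the expression ad_XY for a fixed X as a linear operator on a space of matrices Y, and we will consider functions of this operator f(ad_X)».  File 6 of W3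
(`OneStepRemainderCoefficients`) typed §A's functional calculus in an abstract complete normed ℂ-algebra; file 1 (`OneStepRemainder`) takes (124)'s coefficient operators `G₁, G₂, G₃` as DATA
`Matrix o o ℂ` on the colour carrier.  THIS FILE supplies the dictionary between the two in the β cell's currency (`Beta.AdjointCarrierWiring`: the adjoint representation in a trace-orthonormal
hermitian component family `e`, `cpxHom` = complexification):
 * **`adLie c e Y`** `: Matrix ι ι ℝ`, `(adLie Y)_{ki} = e_k · (i[Y, e_i])` — the component matrix of `i·ad_Y` (hermitian-preserving for hermitian `Y`);
 * `fro_comm_le`: `fro(i[Y,X]) ≤ 4‖Y‖²·fro X` for hermitian `X, Y` (the β cell's Hilbert–Schmidt bookkeeping), `adLie_real_bound` (Parseval), and **`norm_cpx_adLie_le`**: `‖cpx(adLie c e Y)‖ ≤ 2‖Y‖`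
   — «`‖ad‖ ≤ 2`» in the tree's `ℓ²`-operator norms;
 * **`coeffG₁`** `Y Yx := g(−i·cpx(adLie Y))·g(−i·cpx(adLie Yx))⁻¹ʳ − 1` (print's `g(−i ad_Y)g⁻¹(−i ad_{Y_x}) − 1`) and **`norm_coeffG₁_le`**: `‖G₁‖ ≤ 32·y` for `‖Y‖, ‖Y_x‖ ≤ y ≤ 1/8` — the (126)
   letter of file 1's data from the loop-logarithm letter `y` ((116) p. 35: «|Y_x| = O(L²α₀)»); and likewise **`coeffG₂`**/**`norm_coeffG₂_le`**, **`coeffG₃`**/**`norm_coeffG₃_le`** (a probability weight over the block sites, print `w_x = L^{−d}`).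
NOT here: `‖Y_x‖ = O(L²α₀)` from (3.35) (a lattice Stokes bound + the matrix logarithm — W3c).
HONEST FRAMING (T4-DAG p. 1).  [folklore] linear algebra + the functional calculus of file 6; nothing of Bałaban's asserted; NOT NE2; **NE2 (U1a) NOT PROVED**; spine PROVED 0/9 unchanged; NOT
continuum YM / infinite volume / mass gap / Clay.  No `sorry`.
-/

noncomputable section

open scoped BigOperators Matrix ComplexOrder Matrix.Norms.L2Operator
open Finset

namespace Summit.QuantumFields.BalabanUV.T4Continuum.NE2.OneStepRemainderAdjoint

open Literature.MathematicalPhysics.QuantumFieldTheory.Balaban1983to89.B9AdOrthogonal (form form_apply parseval)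
open Summit.QuantumFields.BalabanUV.Beta.ThinLoopHolonomy (cpxHom cpxHom_apply norm_le_of_mulVec_le)
open Summit.QuantumFields.BalabanUV.Beta.AdjointCarrierWiring (fro fro_nonneg fro_conjTranspose fro_add_le fro_mul_le form_self_eq_fro form_combination)
open Summit.QuantumFields.BalabanUV.T4Continuum.NE2.OneStepRemainderCoefficients (gFun norm_coeff₁_le)

variable {n : Type} [Fintype n] [DecidableEq n] {ι : Type}

/-! ## §1 The component matrix of `i·ad_Y` -/

/-- **THE INFINITESIMAL ADJOINT CARRIER**: `(adLie c e Y)_{ki} = e_k · (i[Y, e_i])`, the component matrix of `X ↦ i[Y,X]` in the family `e`.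
[cite: Balaban1985Averaging, p.22 (the operator ad_X and f(ad_X))] [folklore] -/
def adLie (c : ℝ) (e : ι → Matrix n n ℂ) (Y : Matrix n n ℂ) : Matrix ι ι ℝ :=
  Matrix.of fun k i => form c (e k) (Complex.I • (Y * e i - e i * Y))

omit [DecidableEq n] in
/-- unfolding equation. [folklore] -/
theorem adLie_apply (c : ℝ) (e : ι → Matrix n n ℂ) (Y : Matrix n n ℂ) (k i : ι) : adLie c e Y k i = form c (e k) (Complex.I • (Y * e i - e i * Y)) := rfl

/-! ## §2 Hilbert–Schmidt bookkeeping for the commutator -/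

omit [DecidableEq n] in
/-- `fro(−M) = fro M`. [folklore] -/
theorem fro_neg (M : Matrix n n ℂ) : fro (-M) = fro M := by
  simp only [fro, Matrix.neg_apply, norm_neg]

omit [DecidableEq n] in
/-- `fro(i·M) = fro M`. [folklore] -/
theorem fro_smul_I (M : Matrix n n ℂ) : fro (Complex.I • M) = fro M := by
  simp only [fro, Matrix.smul_apply, smul_eq_mul, norm_mul, Complex.norm_I, one_mul]

/-- **`fro(i[Y,X]) ≤ 4‖Y‖²·fro X`** for hermitian `X, Y` (`fro(YX) ≤ ‖Y‖²fro X`, `fro(XY) = fro((XY)ᴴ) = fro(YX)`). [folklore] -/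
theorem fro_comm_le {X Y : Matrix n n ℂ} (hX : X.IsHermitian) (hY : Y.IsHermitian) : fro (Complex.I • (Y * X - X * Y)) ≤ 4 * ‖Y‖ ^ 2 * fro X := by
  rw [fro_smul_I, sub_eq_add_neg]
  have h1 : fro (Y * X) ≤ ‖Y‖ ^ 2 * fro X := fro_mul_le Y X
  have h2 : fro (-(X * Y)) ≤ ‖Y‖ ^ 2 * fro X := by
    rw [fro_neg, ← fro_conjTranspose, Matrix.conjTranspose_mul, hX.eq, hY.eq]
    exact fro_mul_le Y X
  refine (fro_add_le _ _).trans ?_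
  nlinarith [h1, h2]

/-! ## §3 The size `‖cpx(adLie Y)‖ ≤ 2‖Y‖` -/

section Size

variable [Fintype ι] [DecidableEq ι] {c : ℝ} (hc : 0 < c) (P : Submodule ℝ (Matrix n n ℂ))
  (hPh : ∀ X ∈ P, X.IsHermitian) (e : ι → Matrix n n ℂ) (he : ∀ k, e k ∈ P)
  (horth : ∀ k l, form c (e k) (e l) = if k = l then (1 : ℝ) else 0)
  (hcompl : ∀ X ∈ P, ∑ k, form c (e k) X • e k = X) (hPad : ∀ Y ∈ P, ∀ X ∈ P, Complex.I • (Y * X - X * Y) ∈ P)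

include hc hPh he horth hcompl hPad in
/-- **THE REAL COMPONENT BOUND**: `Σ_k (Σ_i (adLie Y)_{ki} a_i)² ≤ 4‖Y‖²·Σ_k a_k²` for `Y ∈ P` and real `a` (Parseval for `X = Σ a_i e_i` and `i[Y,X]`, then `fro_comm_le`). [folklore] -/
theorem adLie_real_bound {Y : Matrix n n ℂ} (hY : Y ∈ P) (a : ι → ℝ) :
    ∑ k, (∑ i, adLie c e Y k i * a i) ^ 2 ≤ 4 * ‖Y‖ ^ 2 * ∑ k, a k ^ 2 := by
  set X : Matrix n n ℂ := ∑ i, a i • e i with hXdef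
  have hX : X ∈ P := P.sum_mem fun i _ => P.smul_mem _ (he i)
  set Z : Matrix n n ℂ := Complex.I • (Y * X - X * Y) with hZdef
  have hZ : Z ∈ P := hPad Y hY X hX
  -- `Z = Σ_i a_i • i(Y e_i − e_i Y)`
  have hZsum : Z = ∑ i, a i • (Complex.I • (Y * e i - e i * Y)) := by
    rw [hZdef, hXdef, Matrix.mul_sum, Matrix.sum_mul, ← Finset.sum_sub_distrib, Finset.smul_sum]
    refine Finset.sum_congr rfl fun i _ => ?_
    rw [Matrix.mul_smul, Matrix.smul_mul, ← smul_sub, smul_comm]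
  have hcoef : ∀ k, ∑ i, adLie c e Y k i * a i = form c (e k) Z := by
    intro k
    rw [hZsum, map_sum]
    refine Finset.sum_congr rfl fun i _ => ?_
    rw [map_smul, smul_eq_mul, adLie_apply, mul_comm]
  have hPZ : ∑ k, form c (e k) Z ^ 2 = form c Z Z := by
    simp_rw [sq]; exact parseval (form c) e (hcompl Z hZ) Z
  have hPX : ∑ k, form c (e k) X ^ 2 = form c X X := by
    simp_rw [sq]; exact parseval (form c) e (hcompl X hX) X
  have hak2 : ∑ k, a k ^ 2 = ∑ k, form c (e k) X ^ 2 :=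
    Finset.sum_congr rfl fun k _ => by rw [hXdef, form_combination e horth a k]
  calc ∑ k, (∑ i, adLie c e Y k i * a i) ^ 2 = ∑ k, form c (e k) Z ^ 2 := Finset.sum_congr rfl fun k _ => by rw [hcoef k]
    _ = c * fro Z := by rw [hPZ, form_self_eq_fro (hPh Z hZ)]
    _ ≤ c * (4 * ‖Y‖ ^ 2 * fro X) := mul_le_mul_of_nonneg_left (fro_comm_le (hPh X hX) (hPh Y hY)) hc.le
    _ = 4 * ‖Y‖ ^ 2 * form c X X := by rw [form_self_eq_fro (hPh X hX)]; ring
    _ = 4 * ‖Y‖ ^ 2 * ∑ k, a k ^ 2 := by rw [← hPX, hak2]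

include hc hPh he horth hcompl hPad in
/-- **`‖cpx(adLie c e Y)‖ ≤ 2‖Y‖`** (`ℓ²`-operator norms; real and imaginary parts separately, as in the β cell's `norm_cpx_adMat_sub_one_le`). [folklore] -/
theorem norm_cpx_adLie_le {Y : Matrix n n ℂ} (hY : Y ∈ P) : ‖cpxHom (adLie c e Y)‖ ≤ 2 * ‖Y‖ := by
  refine norm_le_of_mulVec_le _ (by positivity) fun v => ?_
  have hre : ∀ k, ((cpxHom (adLie c e Y) *ᵥ v) k).re = ∑ i, adLie c e Y k i * (v i).re := by
    intro k
    simp only [Matrix.mulVec, dotProduct, cpxHom_apply, Complex.re_sum, Complex.re_ofReal_mul]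
  have him : ∀ k, ((cpxHom (adLie c e Y) *ᵥ v) k).im = ∑ i, adLie c e Y k i * (v i).im := by
    intro k
    simp only [Matrix.mulVec, dotProduct, cpxHom_apply, Complex.im_sum, Complex.im_ofReal_mul]
  have hsq : ‖(WithLp.toLp 2 (cpxHom (adLie c e Y) *ᵥ v) : EuclideanSpace ℂ ι)‖ ^ 2 =
      ∑ k, (∑ i, adLie c e Y k i * (v i).re) ^ 2 + ∑ k, (∑ i, adLie c e Y k i * (v i).im) ^ 2 := by
    rw [EuclideanSpace.norm_sq_eq, ← Finset.sum_add_distrib]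
    refine Finset.sum_congr rfl fun k _ => ?_
    rw [PiLp.toLp_apply, Complex.sq_norm, Complex.normSq_apply, hre, him]
    ring
  have hv : ‖(WithLp.toLp 2 v : EuclideanSpace ℂ ι)‖ ^ 2 = ∑ k, (v k).re ^ 2 + ∑ k, (v k).im ^ 2 := by
    rw [EuclideanSpace.norm_sq_eq, ← Finset.sum_add_distrib]
    refine Finset.sum_congr rfl fun k _ => ?_
    rw [PiLp.toLp_apply, Complex.sq_norm, Complex.normSq_apply]
    ring
  have h1 := adLie_real_bound hc P hPh e he horth hcompl hPad hY (fun i => (v i).re)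
  have h2 := adLie_real_bound hc P hPh e he horth hcompl hPad hY (fun i => (v i).im)
  have hsq_le : ‖(WithLp.toLp 2 (cpxHom (adLie c e Y) *ᵥ v) : EuclideanSpace ℂ ι)‖ ^ 2 ≤ (2 * ‖Y‖ * ‖(WithLp.toLp 2 v : EuclideanSpace ℂ ι)‖) ^ 2 := by
    rw [hsq, mul_pow, mul_pow, hv]
    nlinarith [h1, h2]
  exact (pow_le_pow_iff_left₀ (norm_nonneg _) (by positivity) two_ne_zero).mp hsq_le

/-! ## §4 (124)'s first coefficient operator as a function of the loop logarithms -/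

variable [Nonempty ι]

/-- **`G₁(Y, Y_x) = g(−i·ad_Y)·g(−i·ad_{Y_x})⁻¹ − 1`** as a colour matrix (`−i·(i ad) = ad`: the argument of `g` is `−i·cpx(adLie)`). [cite: Balaban1985Averaging, (124) p.36] [folklore] -/
def coeffG₁ (c : ℝ) (e : ι → Matrix n n ℂ) (Y Yx : Matrix n n ℂ) : Matrix ι ι ℂ :=
  gFun (-(Complex.I • cpxHom (adLie c e Y))) * Ring.inverse (gFun (-(Complex.I • cpxHom (adLie c e Yx)))) - 1

include hc hPh he horth hcompl hPad in
/-- **THE (126) LETTER FROM THE LOOP-LOGARITHM LETTER**: for `Y, Y_x ∈ P` with `‖Y‖, ‖Y_x‖ ≤ y ≤ 1/8`, `‖G₁(Y, Y_x)‖ ≤ 32·y` — print's «the operators occurring in these terms can be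
estimated by O(L²α₀)» with `y = O(L²α₀)`. [cite: Balaban1985Averaging, p.36] [folklore] -/
theorem norm_coeffG₁_le {Y Yx : Matrix n n ℂ} (hY : Y ∈ P) (hYx : Yx ∈ P) {y : ℝ} (hy0 : 0 ≤ y) (hy : y ≤ 1 / 8) (hYn : ‖Y‖ ≤ y) (hYxn : ‖Yx‖ ≤ y) :
    ‖coeffG₁ c e Y Yx‖ ≤ 32 * y := by
  have hA : ‖-(Complex.I • cpxHom (adLie c e Y))‖ ≤ 2 * y := by
    rw [norm_neg, norm_smul, Complex.norm_I, one_mul]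
    exact (norm_cpx_adLie_le hc P hPh e he horth hcompl hPad hY).trans (by linarith)
  have hB : ‖-(Complex.I • cpxHom (adLie c e Yx))‖ ≤ 2 * y := by
    rw [norm_neg, norm_smul, Complex.norm_I, one_mul]
    exact (norm_cpx_adLie_le hc P hPh e he horth hcompl hPad hYx).trans (by linarith)
  have h := norm_coeff₁_le (𝔸 := Matrix ι ι ℂ) (y := 2 * y) (by linarith) (by linarith) hA hB
  rw [coeffG₁]
  linarith

/-- **`G₂(Y, Y_x) = g(−i·ad_Y)·g(i·ad_{Y_x})⁻¹·e^{−i·ad_Y} − 1`** as a colour matrix. [cite: Balaban1985Averaging, (124) p.36] [folklore] -/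
def coeffG₂ (c : ℝ) (e : ι → Matrix n n ℂ) (Y Yx : Matrix n n ℂ) : Matrix ι ι ℂ :=
  gFun (-(Complex.I • cpxHom (adLie c e Y))) * Ring.inverse (gFun (Complex.I • cpxHom (adLie c e Yx)))
    * NormedSpace.exp (-(Complex.I • cpxHom (adLie c e Y))) - 1

include hc hPh he horth hcompl hPad in
/-- the (126) letter of `G₂`: `‖G₂(Y, Y_x)‖ ≤ 32·y` for `‖Y‖, ‖Y_x‖ ≤ y ≤ 1/8`. [cite: Balaban1985Averaging, p.36] [folklore] -/
theorem norm_coeffG₂_le {Y Yx : Matrix n n ℂ} (hY : Y ∈ P) (hYx : Yx ∈ P) {y : ℝ} (hy0 : 0 ≤ y) (hy : y ≤ 1 / 8) (hYn : ‖Y‖ ≤ y) (hYxn : ‖Yx‖ ≤ y) :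
    ‖coeffG₂ c e Y Yx‖ ≤ 32 * y := by
  have hA : ‖-(Complex.I • cpxHom (adLie c e Y))‖ ≤ 2 * y := by
    rw [norm_neg, norm_smul, Complex.norm_I, one_mul]
    exact (norm_cpx_adLie_le hc P hPh e he horth hcompl hPad hY).trans (by linarith)
  have hB : ‖Complex.I • cpxHom (adLie c e Yx)‖ ≤ 2 * y := by
    rw [norm_smul, Complex.norm_I, one_mul]
    exact (norm_cpx_adLie_le hc P hPh e he horth hcompl hPad hYx).trans (by linarith)
  have h := OneStepRemainderCoefficients.norm_coeff₂_le (𝔸 := Matrix ι ι ℂ) (y := 2 * y) (by linarith) (by linarith) hA hB hA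
  rw [coeffG₂]
  linarith

/-- **`G₃(Y, (Y_x)_x) = e^{i·ad_Y} − g(−i·ad_Y)·Σ_x w_x g(i·ad_{Y_x})⁻¹`** as a colour matrix, for a weight `w` on the block sites (print: `w_x = L^{−d}`). [cite: Balaban1985Averaging, (124) p.36] [folklore] -/
def coeffG₃ {κ : Type*} (s : Finset κ) (w : κ → ℝ) (c : ℝ) (e : ι → Matrix n n ℂ) (Y : Matrix n n ℂ) (Yx : κ → Matrix n n ℂ) : Matrix ι ι ℂ :=
  NormedSpace.exp (Complex.I • cpxHom (adLie c e Y))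
    - gFun (-(Complex.I • cpxHom (adLie c e Y))) * ∑ x ∈ s, (w x : ℂ) • Ring.inverse (gFun (Complex.I • cpxHom (adLie c e (Yx x))))

include hc hPh he horth hcompl hPad in
/-- the (126) letter of `G₃`: `‖G₃‖ ≤ 32·y` for a probability weight `w` and `‖Y‖, ‖Y_x‖ ≤ y ≤ 1/8` on the block. [cite: Balaban1985Averaging, p.36] [folklore] -/
theorem norm_coeffG₃_le {κ : Type*} (s : Finset κ) {w : κ → ℝ} (hw0 : ∀ x ∈ s, 0 ≤ w x) (hw1 : ∑ x ∈ s, w x = 1) {Y : Matrix n n ℂ} {Yx : κ → Matrix n n ℂ}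
    (hY : Y ∈ P) (hYx : ∀ x ∈ s, Yx x ∈ P) {y : ℝ} (hy0 : 0 ≤ y) (hy : y ≤ 1 / 8) (hYn : ‖Y‖ ≤ y) (hYxn : ∀ x ∈ s, ‖Yx x‖ ≤ y) :
    ‖coeffG₃ s w c e Y Yx‖ ≤ 32 * y := by
  have hA : ‖-(Complex.I • cpxHom (adLie c e Y))‖ ≤ 2 * y := by
    rw [norm_neg, norm_smul, Complex.norm_I, one_mul]
    exact (norm_cpx_adLie_le hc P hPh e he horth hcompl hPad hY).trans (by linarith)
  have hC : ‖Complex.I • cpxHom (adLie c e Y)‖ ≤ 2 * y := by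
    rw [norm_smul, Complex.norm_I, one_mul]
    exact (norm_cpx_adLie_le hc P hPh e he horth hcompl hPad hY).trans (by linarith)
  have hB : ∀ x ∈ s, ‖Complex.I • cpxHom (adLie c e (Yx x))‖ ≤ 2 * y := by
    intro x hx
    rw [norm_smul, Complex.norm_I, one_mul]
    exact (norm_cpx_adLie_le hc P hPh e he horth hcompl hPad (hYx x hx)).trans (by linarith [hYxn x hx])
  have h := OneStepRemainderCoefficients.norm_coeff₃_le (𝔸 := Matrix ι ι ℂ) s hw0 hw1 (B := fun x => Complex.I • cpxHom (adLie c e (Yx x)))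
    (y := 2 * y) (by linarith) (by linarith) hA hC hB
  rw [coeffG₃]
  linarith

end Size

end Summit.QuantumFields.BalabanUV.T4Continuum.NE2.OneStepRemainderAdjoint

end
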